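import Literature.MathematicalPhysics.QuantumFieldTheory.Balaban1983to89.Beta.AveragedAFCarrierStepDrift
import Literature.MathematicalPhysics.QuantumFieldTheory.Balaban1983to89.Beta.BalabanStepJetsSucc

/-!
# Beta / AveragedAFCarrierJsBal — the whole located [III] list OVER THE WALL'S CLOSED TERM `D1Drift Lc (JsBalOf …) N μ ν`
# (β sub-cell, [III]-side CO-LEAD unit `b2b-balaban-strat-b14` gen 24; trigger (t4) of MISSING-B14 §9.34 (d)/§9.36: the COMPLETED family
# `JsBal := fun j ↦ dress (JsBal⁰ j)` LANDED — an2 `Beta.BalabanStepJetsSucc` v1 p192868; lead BINDER CHECK journal l.59396, `BETA/WALL.md` v2.18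
# «THE WALL STATEMENT IS A CLOSED TERM OF THE TREE MODULO NAMED BINDERS»)

HONEST FRAMING (page 1 of everything the β sub-cell writes): discharging `BetaPertH` makes Bałaban's UV stability UNCONDITIONAL — a
real constructive-QFT result; it is NOT the continuum limit and NOT the Clay problem.  THIS MODULE is CLASS-LEVEL BOOKKEEPING: it
instantiates this lineage's `AveragedAFCarrierStepDrift` (v1.4, p190579: the [III] list from the closed Prop `D1Drift Lc Js N μ ν` over
ABSTRACT step jet data `Js : ℕ → JetData 3 Lc`) at the ONE family the wall statement is now written over — an2's
`BalabanStepJetsSucc.JsBalOf hLc cE cVH cΛ W Cw δw hδw hW : ℕ → JetData 3 Lc` (`:= fun j ↦ AxialDressing.dress (JsBal0Of … j)`, route (α),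
RULING (R29)) — and asserts nothing printed by Bałaban; every statement is [folklore] bookkeeping over the cell's hypothesis carriers.
EVERY load-bearing β-binder below (`D1Drift`, `SDInvisible`, `D1Rep`, P5′, `hbase`, `RemainderConst`, `BetaContH`) is a HYPOTHESIS;
for the family `JsBalOf …` the binder `hD : D1Drift Lc (JsBalOf …) N μ ν` IS THE WALL (EXIT-A of the cell) — nothing here proves it,
and nothing here could: the wall is UNTOUCHED; road-(1) verdict unchanged (PRECISELY WALLED at END-STATEMENT grade; nothing of
(M2⁺)/`BetaPertH` discharged); value = census precision (MISSING-B14 §9 Table 9.1: the `hD` column of the [III] carrier is a CLOSED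
TERM of the tree modulo the named binders (P4) `W …`, (P6) `cE cVH cΛ`, (P6′) the UNITS numerals inside `Sstep`), NOT summit progress.

ABSOLUTE RULE (cell charter, verbatim): "No internally-minted statement may enter as a cited fact. Every hypothesis is either
kernel-proved in this package or a verbatim quotation of a PUBLISHED theorem with page reference. The manuscript(s) under audit are
NOT citable for their own disputed steps — they are the thing under adjudication; programme-internal (2001/route/tribunal) claims
are never citable."

## Why this leaf exists (and why it is a separate leaf)

`BETA/WALL.md` v2.18 (lead `b2b-balaban-strat-b12`, journal l.59426): with `BalabanStepJetsSucc` v1 in the tree the located one-loop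
item of the wall is the CLOSED TERM `OneStepKernelFamily.D1Drift Lc (BalabanStepJetsSucc.JsBalOf hLc cE cVH cΛ W Cw δw hδw hW) N μ ν`
(`d = 3`) modulo the named binders: the second-order tables `W : ℕ → …` with their localisation data `Cw δw hδw hW` (work-order (P4)),
the colour weights `cE cVH cΛ : ℝ` (work-order (P6)), and — inside the stencil `BalabanStepJetsSucc.Sstep`, BY NAME, invisible to every
lemma — the two UNITS numerals `wE`/`wΛ` (PROVISIONAL, work-order (P6′)).  The [III] side so far read the wall's statement over an
abstract `Js` (`AveragedAFCarrierStepDrift` §1/§4–§6).  This leaf writes the SAME theorems over the closed term, so that a (T-def)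
brick / the T⁴ cell / MISSING-B14 Table 9.1 read the whole located [III] list for BAŁABAN'S COMPLETED FAMILY off ONE theorem BY NAME
whose only β-hypothesis about that family is the wall itself:

* §1 STATEMENT FORM over the closed term: `wallEND_of_D1Drift_JsBalOf_cont_allProfiles` — binders = the family's own binders
  (`hLc`, `cE cVH cΛ`, `W Cw δw hδw hW`) + EXACTLY those of `AveragedAFCarrierStepDrift.wallEND_of_D1Drift_remainderConst_cont_allProfiles`
  at `Js := JsBalOf …` (`ForwardGenerated`, the split `S` with `hβ : ∀ j, S.β0 j = secondMoment (TbalOf Lc (JsBalOf …) j) μ ν`,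
  **`hD : D1Drift Lc (JsBalOf …) N μ ν`**, (D4) `RemainderConst S γ₀ r` with `r < stepBal N Lc` STRICTLY, (C) `BetaContH γ₀ β`, `0 < γ₀`,
  the [III] run-side data) ⟹ `EndpointExistence C ∧ ∃ A, ∃ γ₁ > 0, ∀ γ ≤ min γ₀ γ₁, ∀ runs in ]0,γ], ∀ p′ ≤ p, ∀ A₀ ≥ 0: sizes (2.5) ∧
  HorizonFacts` with `β′ := stepBal N Lc + 2A + r`; `flowIneq_of_D1Drift_JsBalOf_allProfiles` ((2.6)–(2.9) alone at `r ≤ stepBal N Lc`,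
  NO (C)); `t4FlowInputs_of_D1Drift_JsBalOf` (the T⁴ cell's flow-fact binders, MISSING-B14 §8 C19/C20); `betaAvgAFH_of_D1Drift_JsBalOf`
  (the minimal [III] carrier `∃ A, BetaAvgAFH (stepBal N Lc − r) (2A) γ β`).  One-line proofs (instantiation).
* §2 THE CLOSED TERM WRITTEN OUT: `d1Drift_JsBalOf_iff` — by an2's `BalabanStepJetsSucc.TbalOf_JsBalOf` (⟸ `AxialDressing.TbalOf_dress`)
  the wall statement IS `∃ A, ∀ k, |Σ_{j<k} secondMoment (hessKer (axDressK Lc (KInvStep Lc j)) (axVertexOfK (KInvStep Lc j) Lc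
  (JsBal0Of … j).S) (W j)) μ ν − stepBal N Lc · k| ≤ A` — the `μ ≠ ν` second moments of the `Πᵀ·K_j·Π`-Hessian kernels with Bałaban's
  stencils `S_j` (`S₀` = `BalabanStepJets.S0`, `S_{j+1}` = `BalabanStepJetsSucc.Sstep … (j+1)`) and tables `W j` drift with the
  asymptotic-freedom slope up to a bounded cumulative defect; `secondMoment_TbalOf_JsBalOf` (member by member); and the END with `hβ`
  in that closed `Π`-form, `wallEND_of_D1Drift_JsBalOf_closedForm_cont_allProfiles` / `betaAvgAFH_of_D1Drift_JsBalOf_closedForm`.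
* §3 THE CENSUS FORM OF THE (D1) PROOF ROUTE (RULING (R28-1), «(D1) proof route = {P5′ (both families), `hbase`, (SDF), `D1Rep`}») WITH
  THE STEP FAMILY CLOSED: `wallEND_of_sdInvisible_D1Rep_JsBalOf_cont_allProfiles` — binders EXACTLY those of
  `AveragedAFCarrierStepDrift.wallEND_of_sdInvisible_D1Rep_cont_allProfiles` (⟸ lead `StepDriftWitness.d1Drift_of_sdInvisible_D1Rep`) at
  `Js := JsBalOf …`, the one-shot composite family `Jc : ∀ m, JetData 3 (Lc ^ m)` LEFT A BINDER (its literal `fun m ↦ dress (jcOf … m)` of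
  `BalabanCompositeJets` is read by the sub-cell; this leaf does not choose it): P5′ of `TbalOf Lc (JsBalOf …)` (`hT0`/`hT1`) and of
  `TshotOf Lc Jc` (`h𝒯0`/`h𝒯1`, `m ≥ 1`), `hbase : TshotOf Lc Jc 1 = TbalOf Lc (JsBalOf …) 0`, (SDF) `SDInvisible Lc (JsBalOf …) Jc μ ν`,
  window data, `D1Rep Lc Jc N μ ν a SL k` + the END binders ⟹ the conclusion of §1; `betaAvgAFH_of_sdInvisible_D1Rep_JsBalOf` (the
  minimal carrier).  These four β-binders are the lead's EXIT-A list «P5′ · `hbase` · (SDF-α) · P7» READ OVER THE CLOSED STEP FAMILY —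
  hypotheses, never facts (RULING (R28-3)).

A SEPARATE LEAF, not `AveragedAFCarrierStepDrift` v1.5: importing `BalabanStepJetsSucc` adds 31 modules (the jets / axial-dressing
closure) that the abstract-`Js` sockets do not need; no import cycle (the 281-module closure of `BalabanStepJetsSucc` contains no
`AveragedAFCarrier*` module).  EXPONENT-AGNOSTIC: the PROVISIONAL UNITS numerals (P6′) live inside `Sstep` and are never unfolded here —
if (R1) re-weights `Sstep`, nothing in this file changes.

NON-VACUITY.  For an ABSTRACT `Js` the END binder list is jointly inhabited (lead `Beta.WallWitness`; `StepDriftWitness.d1Drift_inhabited`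
/ `d1Drift_genuine`).  For the closed family `JsBalOf …` the inhabitation of `hD` is EXACTLY the open wall — no witness is offered or
possible here, by design; the theorems are implications.  READING CLAUSE (W-KKT-2) as in `AveragedAFCarrierStepDrift` /
`OneStepKernelFamily` / `BalabanStepJetsSucc` (headers): the identification of `TbalOf Lc (JsBalOf …) j`'s `μ ≠ ν` second moment with the
printed (1.22) coefficient of [Balaban1987RG1] p. 264 is the sub-cell's READING, delivered with (T-def) — NOT asserted by any theorem here.

Source located (consumer locators, quoted verbatim in `B14FlowStep` / `AveragedAFCarrier`, nothing newly quoted): [Balaban1987RG1,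
Thm 2 p.259, Thm 3 p.264]; [Balaban1988Convergent, (2.5)–(2.9) pp.255–256, (2.28) p.259, (2.46) p.263].
-/

noncomputable section

namespace Literature.MathematicalPhysics.QuantumFieldTheory.Balaban1983to89.Beta.AveragedAFCarrierJsBal

open Finset
open Literature.MathematicalPhysics.QuantumFieldTheory.Balaban1983to89
open FlowStep FlowStepRuns DagBinding B14DeltaBeta
open Literature.MathematicalPhysics.QuantumFieldTheory.Balaban1983to89.Beta.Drift (OneLoopDrift)
open Literature.MathematicalPhysics.QuantumFieldTheory.Balaban1983to89.Beta.RemainderChain (RemainderConst)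
open Literature.MathematicalPhysics.QuantumFieldTheory.Balaban1983to89.Beta.VectorTailsLoc (fam kfam)
open Literature.MathematicalPhysics.QuantumFieldTheory.Balaban1983to89.Beta.VectorLegVolumeAdapter (MvE)
open Literature.MathematicalPhysics.QuantumFieldTheory.Balaban1983to89.Beta.OneStepResolventKernel (Fib JetData)
open Literature.MathematicalPhysics.QuantumFieldTheory.Balaban1983to89.Beta.OneStepKernelFamily
  (KInvStep TbalOf TshotOf D1Rep D1Drift)
open Literature.MathematicalPhysics.QuantumFieldTheory.Balaban1983to89.Beta.StepDriftWitness (SDInvisible)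
open Literature.MathematicalPhysics.QuantumFieldTheory.Balaban1983to89.Beta.AxialDressing (axDressK axVertexOfK)
open Literature.MathematicalPhysics.QuantumFieldTheory.Balaban1983to89.Beta.BalabanStepJetsSucc (JsBal0Of JsBalOf TbalOf_JsBalOf)
open Literature.MathematicalPhysics.QuantumFieldTheory.Balaban1983to89.B12Beta (secondMoment)
open ExpKernelCalculus (VertexFamily₂ hessKer)
open ComposedRoad AveragedAFCarrier AveragedAFCarrierScalewise AveragedAFCarrierStepDrift

variable {β : HBeta} {Lc : ℕ} [NeZero Lc] {Λ : Type*}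
  (hLc : 1 ≤ Lc) (cE cVH cΛ : ℝ)
  (W : ℕ → Fin 4 → (Fin 4 → ℤ) → Fin 4 → (Fin 4 → ℤ) → ExpKernelCalculus.MKer 4 (Fib 3))
  (Cw δw : ℕ → ℝ) (hδw : ∀ j, 0 < δw j) (hW : ∀ j, VertexFamily₂ (W j) Lc (Cw j) (δw j))

/-! ## §1 The wall's closed term `D1Drift Lc (JsBalOf …) N μ ν` ⟹ the whole located [III] list (statement form) -/

section StatementForm

/-- **THE WHOLE LOCATED [III] LIST OVER THE WALL'S CLOSED TERM, ALL PROFILES** — `AveragedAFCarrierStepDrift.wallEND_of_D1Drift_remainderConst_cont_allProfiles`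
at `Js := BalabanStepJetsSucc.JsBalOf hLc cE cVH cΛ W Cw δw hδw hW` (Bałaban's completed, axially dressed step-jet family; binders (P4)
`W Cw δw hδw hW`, (P6) `cE cVH cΛ`): from `ForwardGenerated`, the split `S` with `hβ` (the split's one-loop numbers ARE the `μ ≠ ν` second
moments of the family's step kernels), **THE WALL `hD : D1Drift Lc (JsBalOf …) N μ ν`**, **(D4) `RemainderConst S γ₀ r` with `r < stepBal N Lc`
STRICTLY**, **(C) `BetaContH γ₀ β`**, `0 < γ₀` and the [III] run-side data ⟹ `EndpointExistence C ∧ ∃ A, ∃ γ₁ > 0, ∀ γ ≤ min γ₀ γ₁,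
∀ runs in ]0,γ], ∀ p′ ≤ p, ∀ A₀ ≥ 0: sizes ∧ HorizonFacts` with `β′ := stepBal N Lc + 2A + r`.  Discharges nothing of `BetaPertH`
(`hD` is the wall). [cite: Balaban1987RG1, Thm 2 p.259 and Thm 3 p.264] [cite: Balaban1988Convergent, (2.5)–(2.9) pp.255–256, (2.28) p.259, (2.46) p.263] -/
theorem wallEND_of_D1Drift_JsBalOf_cont_allProfiles {C : B12.Construction} (hgen : ForwardGenerated C β)
    (hhalt : HaltsOutside C β) (hcur : CurriesHBeta C β) (S : B12Beta.OneLoopSplit β) {N : ℝ} {μ ν : Fin 4}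
    (hβ : ∀ j, S.β0 j = secondMoment (TbalOf Lc (JsBalOf hLc cE cVH cΛ W Cw δw hδw hW) j) μ ν)
    (hD : D1Drift Lc (JsBalOf hLc cE cVH cΛ W Cw δw hδw hW) N μ ν) {γ₀ r β₀ : ℝ}
    (hγ₀ : 0 < γ₀) (hrem : RemainderConst S γ₀ r) (hr : r < B12Normalization.stepBal N Lc) (hcont : BetaContH γ₀ β)
    (hβ₀ : 0 < β₀) {L : ℕ} (hL2 : 2 ≤ L) (p : ℕ) {κ₀ : ℕ} (hκ : 6 ≤ κ₀) :
    EndpointExistence C ∧ ∃ A : ℝ, ∃ γ₁ : ℝ, 0 < γ₁ ∧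
      ∀ γ : ℝ, 0 < γ → γ ≤ min γ₀ γ₁ → ∀ Pr : B12.RunParams, (C Pr).flow.InInterval γ Pr.K →
        ∀ p' : ℕ, p' ≤ p → ∀ A₀ : ℝ, 0 ≤ A₀ →
          ∃ Rj : ℕ → ℕ, (∀ j, B14.IsRj L p' ((C Pr).flow.g j) (Rj j)) ∧
            HorizonFacts (C Pr).flow (B12Normalization.stepBal N Lc + 2 * A + r) β₀ A₀ L p' κ₀ Rj Pr.K :=
  wallEND_of_D1Drift_remainderConst_cont_allProfiles hgen hhalt hcur S (JsBalOf hLc cE cVH cΛ W Cw δw hδw hW) hβ hD hγ₀ hrem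
    hr hcont hβ₀ hL2 p hκ

/-- **… AT `r ≤ stepBal N Lc`, NO (C): (2.6)–(2.9) FOR ALL PROFILES** over the closed term (β′ := stepBal N Lc + 2A + r, `A` the
drift's defect) — `AveragedAFCarrierStepDrift.flowIneq_of_D1Drift_remainderConst_allProfiles` at `Js := JsBalOf …`. [cite: Balaban1988Convergent, (2.5)–(2.9) pp.255–256] -/
theorem flowIneq_of_D1Drift_JsBalOf_allProfiles {C : B12.Construction} (hgen : ForwardGenerated C β)
    (hhalt : HaltsOutside C β) (hcur : CurriesHBeta C β) (S : B12Beta.OneLoopSplit β) {N : ℝ} {μ ν : Fin 4}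
    (hβ : ∀ j, S.β0 j = secondMoment (TbalOf Lc (JsBalOf hLc cE cVH cΛ W Cw δw hδw hW) j) μ ν)
    (hD : D1Drift Lc (JsBalOf hLc cE cVH cΛ W Cw δw hδw hW) N μ ν) {γ₀ r β₀ : ℝ}
    (hγ₀ : 0 < γ₀) (hrem : RemainderConst S γ₀ r) (hr : r ≤ B12Normalization.stepBal N Lc) (hβ₀ : 0 < β₀) {L : ℕ}
    (hL2 : 2 ≤ L) (p : ℕ) :
    ∃ A : ℝ, ∃ γ₁ : ℝ, 0 < γ₁ ∧
      ∀ γ : ℝ, 0 < γ → γ ≤ min γ₀ γ₁ → ∀ Pr : B12.RunParams, (C Pr).flow.InInterval γ Pr.K →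
        ∀ p' : ℕ, p' ≤ p → ∀ A₀ : ℝ, 0 ≤ A₀ →
          ∃ Rj : ℕ → ℕ, (∀ j, B14.IsRj L p' ((C Pr).flow.g j) (Rj j)) ∧
            B14.FlowIneq26 (C Pr).flow.g (B12Normalization.stepBal N Lc + 2 * A + r) β₀ Pr.K ∧
            B14.FlowIneq27 (C Pr).flow.g (B12Normalization.stepBal N Lc + 2 * A + r) β₀ p' Pr.K ∧
            B14.FlowIneq28 (epsK A₀ p' (C Pr).flow) (C Pr).flow.g (B12Normalization.stepBal N Lc + 2 * A + r) β₀ Pr.K ∧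
            B14FlowStep.FlowIneq29 Rj (C Pr).flow.g L (B12Normalization.stepBal N Lc + 2 * A + r) β₀ Pr.K :=
  flowIneq_of_D1Drift_remainderConst_allProfiles hgen hhalt hcur S (JsBalOf hLc cE cVH cΛ W Cw δw hδw hW) hβ hD hγ₀ hrem hr hβ₀
    hL2 p

/-- **… AT `r ≤ stepBal N Lc`, NO (C): THE T⁴ CELL's FLOW-FACT BINDERS (MISSING-B14 §8 C19/C20) over the closed term** —
`AveragedAFCarrierStepDrift.t4FlowInputs_of_D1Drift_remainderConst` at `Js := JsBalOf …`. [cite: Balaban1988Convergent, (2.5)–(2.9) pp.255–256] -/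
theorem t4FlowInputs_of_D1Drift_JsBalOf {C : B12.Construction} (hgen : ForwardGenerated C β)
    (hhalt : HaltsOutside C β) (hcur : CurriesHBeta C β) (S : B12Beta.OneLoopSplit β) {N : ℝ} {μ ν : Fin 4}
    (hβ : ∀ j, S.β0 j = secondMoment (TbalOf Lc (JsBalOf hLc cE cVH cΛ W Cw δw hδw hW) j) μ ν)
    (hD : D1Drift Lc (JsBalOf hLc cE cVH cΛ W Cw δw hδw hW) N μ ν) {γ₀ r β₀ : ℝ}
    (hγ₀ : 0 < γ₀) (hrem : RemainderConst S γ₀ r) (hr : r ≤ B12Normalization.stepBal N Lc) (hβ₀ : 0 < β₀) {L : ℕ}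
    (hL2 : 2 ≤ L) {p₀ r' : ℕ} (hr' : r' ≤ p₀) :
    ∃ A : ℝ, ∃ γ₁ : ℝ, 0 < γ₁ ∧ ∀ γ : ℝ, 0 < γ → γ ≤ min γ₀ γ₁ → ∀ Pr : B12.RunParams, (C Pr).flow.InInterval γ Pr.K →
      B14.FlowIneq27 (C Pr).flow.g (B12Normalization.stepBal N Lc + 2 * A + r) β₀ p₀ Pr.K ∧
      (∀ j, j ≤ Pr.K → 1 ≤ Real.log (((C Pr).flow.g j) ^ 2)⁻¹) ∧
      ∃ Rj : ℕ → ℕ, (∀ j, B14.IsRj L r' ((C Pr).flow.g j) (Rj j)) ∧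
        B14FlowStep.FlowIneq29 Rj (C Pr).flow.g L (B12Normalization.stepBal N Lc + 2 * A + r) β₀ Pr.K :=
  t4FlowInputs_of_D1Drift_remainderConst hgen hhalt hcur S (JsBalOf hLc cE cVH cΛ W Cw δw hδw hW) hβ hD hγ₀ hrem hr hβ₀ hL2 hr'

/-- **THE MINIMAL [III] CARRIER OVER THE CLOSED TERM**: the wall `D1Drift Lc (JsBalOf …) N μ ν` + `hβ` + (D4) `RemainderConst S γ r` ⟹
`∃ A, BetaAvgAFH (stepBal N Lc − r) (2A) γ β` (MISSING-B14 §9 Table 9.1: slope `stepBal − r`, defect twice the drift's; slope `> 0` iff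
`r < stepBal N Lc`) — `AveragedAFCarrierStepDrift.betaAvgAFH_of_D1Drift_remainderConst` at `Js := JsBalOf …`. [folklore] -/
theorem betaAvgAFH_of_D1Drift_JsBalOf (S : B12Beta.OneLoopSplit β) {N : ℝ} {μ ν : Fin 4}
    (hβ : ∀ j, S.β0 j = secondMoment (TbalOf Lc (JsBalOf hLc cE cVH cΛ W Cw δw hδw hW) j) μ ν)
    (hD : D1Drift Lc (JsBalOf hLc cE cVH cΛ W Cw δw hδw hW) N μ ν) {γ r : ℝ} (hrem : RemainderConst S γ r) :
    ∃ A : ℝ, BetaAvgAFH (B12Normalization.stepBal N Lc - r) (2 * A) γ β :=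
  betaAvgAFH_of_D1Drift_remainderConst S (JsBalOf hLc cE cVH cΛ W Cw δw hδw hW) hβ hD hrem

end StatementForm

/-! ## §2 The closed term written out: the wall in closed `Π`-form (`BalabanStepJetsSucc.TbalOf_JsBalOf`) -/

section ClosedForm

/-- **THE FAMILY'S ONE-LOOP NUMBERS, MEMBER BY MEMBER, IN CLOSED `Π`-FORM**: the `(μ, ν)` second moment of the wall's `j`-th step kernel
is that of `hessKer (Πᵀ·KInvStep Lc j·Π) (V^Π_{KInvStep Lc j} S_j) (W j)` with `S_j = (JsBal0Of … j).S` Bałaban's undressed stencil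
(`S₀ = BalabanStepJets.S0`, `S_{j+1} = BalabanStepJetsSucc.Sstep … (j+1)`) — an2's `TbalOf_JsBalOf` under `secondMoment`. [folklore] -/
theorem secondMoment_TbalOf_JsBalOf (j : ℕ) (μ ν : Fin 4) :
    secondMoment (TbalOf Lc (JsBalOf hLc cE cVH cΛ W Cw δw hδw hW) j) μ ν
      = secondMoment (hessKer (axDressK Lc (KInvStep (d := 3) Lc j))
          (axVertexOfK (KInvStep (d := 3) Lc j) Lc (JsBal0Of hLc cE cVH cΛ W Cw δw hδw hW j).S) (W j)) μ ν := by
  rw [TbalOf_JsBalOf]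

/-- **THE WALL STATEMENT WRITTEN OUT** (`BETA/WALL.md` v2.18's closed term, unfolded once through `D1Drift` and `TbalOf_JsBalOf`):
`D1Drift Lc (JsBalOf …) N μ ν` IS «the `(μ, ν)` second moments of the `Πᵀ·K_j·Π`-Hessian kernels with Bałaban's stencils and tables drift
with the asymptotic-freedom slope `stepBal N Lc = (11N²/(12π²))·log Lc` up to a bounded cumulative defect»:
`∃ A, ∀ k, |Σ_{j<k} secondMoment (hessKer (axDressK Lc (KInvStep Lc j)) (axVertexOfK (KInvStep Lc j) Lc (JsBal0Of … j).S) (W j)) μ ν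
− stepBal N Lc · k| ≤ A`.  A restatement of the hypothesis, not a step towards it. [folklore] -/
theorem d1Drift_JsBalOf_iff {N : ℝ} {μ ν : Fin 4} :
    D1Drift Lc (JsBalOf hLc cE cVH cΛ W Cw δw hδw hW) N μ ν ↔
      ∃ A : ℝ, ∀ k : ℕ,
        |∑ j ∈ Finset.range k,
            secondMoment (hessKer (axDressK Lc (KInvStep (d := 3) Lc j))
              (axVertexOfK (KInvStep (d := 3) Lc j) Lc (JsBal0Of hLc cE cVH cΛ W Cw δw hδw hW j).S) (W j)) μ ν
          - B12Normalization.stepBal N Lc * k| ≤ A := by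
  have h : (fun j => secondMoment (TbalOf Lc (JsBalOf hLc cE cVH cΛ W Cw δw hδw hW) j) μ ν)
      = fun j => secondMoment (hessKer (axDressK Lc (KInvStep (d := 3) Lc j))
          (axVertexOfK (KInvStep (d := 3) Lc j) Lc (JsBal0Of hLc cE cVH cΛ W Cw δw hδw hW j).S) (W j)) μ ν := by
    funext j; rw [TbalOf_JsBalOf]
  unfold D1Drift OneLoopDrift
  rw [h]

/-- **THE [III] LIST OVER THE CLOSED TERM WITH `hβ` IN CLOSED `Π`-FORM** — §1 `wallEND_of_D1Drift_JsBalOf_cont_allProfiles` with the split's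
numbers given directly as the second moments of the `Πᵀ·K_j·Π`-Hessian kernels (`hβ` rewritten by `secondMoment_TbalOf_JsBalOf`); same
conclusion, same `β′ := stepBal N Lc + 2A + r`.  Discharges nothing of `BetaPertH`.
[cite: Balaban1987RG1, Thm 2 p.259 and Thm 3 p.264] [cite: Balaban1988Convergent, (2.5)–(2.9) pp.255–256, (2.28) p.259, (2.46) p.263] -/
theorem wallEND_of_D1Drift_JsBalOf_closedForm_cont_allProfiles {C : B12.Construction} (hgen : ForwardGenerated C β)
    (hhalt : HaltsOutside C β) (hcur : CurriesHBeta C β) (S : B12Beta.OneLoopSplit β) {N : ℝ} {μ ν : Fin 4}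
    (hβ : ∀ j, S.β0 j = secondMoment (hessKer (axDressK Lc (KInvStep (d := 3) Lc j))
      (axVertexOfK (KInvStep (d := 3) Lc j) Lc (JsBal0Of hLc cE cVH cΛ W Cw δw hδw hW j).S) (W j)) μ ν)
    (hD : D1Drift Lc (JsBalOf hLc cE cVH cΛ W Cw δw hδw hW) N μ ν) {γ₀ r β₀ : ℝ}
    (hγ₀ : 0 < γ₀) (hrem : RemainderConst S γ₀ r) (hr : r < B12Normalization.stepBal N Lc) (hcont : BetaContH γ₀ β)
    (hβ₀ : 0 < β₀) {L : ℕ} (hL2 : 2 ≤ L) (p : ℕ) {κ₀ : ℕ} (hκ : 6 ≤ κ₀) :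
    EndpointExistence C ∧ ∃ A : ℝ, ∃ γ₁ : ℝ, 0 < γ₁ ∧
      ∀ γ : ℝ, 0 < γ → γ ≤ min γ₀ γ₁ → ∀ Pr : B12.RunParams, (C Pr).flow.InInterval γ Pr.K →
        ∀ p' : ℕ, p' ≤ p → ∀ A₀ : ℝ, 0 ≤ A₀ →
          ∃ Rj : ℕ → ℕ, (∀ j, B14.IsRj L p' ((C Pr).flow.g j) (Rj j)) ∧
            HorizonFacts (C Pr).flow (B12Normalization.stepBal N Lc + 2 * A + r) β₀ A₀ L p' κ₀ Rj Pr.K :=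
  wallEND_of_D1Drift_JsBalOf_cont_allProfiles hLc cE cVH cΛ W Cw δw hδw hW hgen hhalt hcur S
    (fun j => by rw [secondMoment_TbalOf_JsBalOf]; exact hβ j) hD hγ₀ hrem hr hcont hβ₀ hL2 p hκ

/-- **THE MINIMAL [III] CARRIER WITH `hβ` IN CLOSED `Π`-FORM**: `∃ A, BetaAvgAFH (stepBal N Lc − r) (2A) γ β`. [folklore] -/
theorem betaAvgAFH_of_D1Drift_JsBalOf_closedForm (S : B12Beta.OneLoopSplit β) {N : ℝ} {μ ν : Fin 4}
    (hβ : ∀ j, S.β0 j = secondMoment (hessKer (axDressK Lc (KInvStep (d := 3) Lc j))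
      (axVertexOfK (KInvStep (d := 3) Lc j) Lc (JsBal0Of hLc cE cVH cΛ W Cw δw hδw hW j).S) (W j)) μ ν)
    (hD : D1Drift Lc (JsBalOf hLc cE cVH cΛ W Cw δw hδw hW) N μ ν) {γ r : ℝ} (hrem : RemainderConst S γ r) :
    ∃ A : ℝ, BetaAvgAFH (B12Normalization.stepBal N Lc - r) (2 * A) γ β :=
  betaAvgAFH_of_D1Drift_JsBalOf hLc cE cVH cΛ W Cw δw hδw hW S
    (fun j => by rw [secondMoment_TbalOf_JsBalOf]; exact hβ j) hD hrem

end ClosedForm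

/-! ## §3 The census form of the (D1) proof route (RULING (R28-1)) with the step family closed: P5′ · `hbase` · (SDF) · `D1Rep` over `JsBalOf …` -/

section CensusForm

/-- **THE CENSUS FORM OF THE (D1) PROOF ROUTE ON THE [III] SIDE, STEP FAMILY CLOSED, ALL PROFILES, β′ DERIVED** —
`AveragedAFCarrierStepDrift.wallEND_of_sdInvisible_D1Rep_cont_allProfiles` (⟸ lead `StepDriftWitness.d1Drift_of_sdInvisible_D1Rep`) at
`Js := JsBalOf hLc cE cVH cΛ W Cw δw hδw hW`, the one-shot composite family `Jc : ∀ m, JetData 3 (Lc ^ m)` a binder.  Binders: the cell's standing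
`h12`/`h126` BY NAME, base-point labels, `μ ≠ ν`, `N ≠ 0`, `2 ≤ Lc`; **P5′ of the closed step family** (`hT0`/`hT1` of `TbalOf Lc (JsBalOf …) j`)
and of the one-shot family (`h𝒯0`/`h𝒯1`, `m ≥ 1`); **`hbase : TshotOf Lc Jc 1 = TbalOf Lc (JsBalOf …) 0`**; **(SDF) `hSF : SDInvisible Lc (JsBalOf …) Jc μ ν`**;
window data; **`hrep : D1Rep Lc Jc N μ ν a SL k`** — the lead's EXIT-A list «P5′ · `hbase` · (SDF-α) · P7» read over the closed step family,
hypotheses never facts (RULING (R28-3)) — plus the END binders of §1 (`ForwardGenerated`, the split `S` with `hβ`, (D4) `RemainderConst S γ₀ rr`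
with `rr < stepBal N Lc` STRICTLY, (C) `BetaContH γ₀ β`, `0 < γ₀`) and the [III] run-side data ⟹ the conclusion of §1 with
`β′ := stepBal N Lc + 2A + rr`.  Discharges nothing of `BetaPertH`.
[cite: Balaban1987RG1, Thm 2 p.259 and Thm 3 p.264] [cite: Balaban1988Convergent, (2.5)–(2.9) pp.255–256, (2.28) p.259, (2.46) p.263] -/
theorem wallEND_of_sdInvisible_D1Rep_JsBalOf_cont_allProfiles (a : ℝ) (ha : 0 < a)
    (h12 : B5.Prop12Printed (fam (fun i : ℕ+ × ℕ => ((i.1 : ℕ+) : ℕ)) (fun i => i.1.pos) MvE a ha))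
    (h126 : B5.Kernel126_127Printed (kfam (fun i : ℕ+ × ℕ => ((i.1 : ℕ+) : ℕ)) MvE))
    {SL : Finset Λ} (hSL : SL.Nonempty) (k : Λ → Fin 4) {μ ν : Fin 4}
    {C : B12.Construction} (hgen : ForwardGenerated C β) (hhalt : HaltsOutside C β) (hcur : CurriesHBeta C β)
    (S : B12Beta.OneLoopSplit β) (hμν : μ ≠ ν) {N : ℝ} (hN : N ≠ 0) (hL : 2 ≤ Lc)
    (Jc : ∀ m : ℕ, JetData 3 (Lc ^ m))
    (hβ : ∀ j, S.β0 j = secondMoment (TbalOf Lc (JsBalOf hLc cE cVH cΛ W Cw δw hδw hW) j) μ ν)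
    (hT0 : ∀ j (c e : Fin 4), HasSum (TbalOf Lc (JsBalOf hLc cE cVH cΛ W Cw δw hδw hW) j c e) 0)
    (hT1 : ∀ j (c e ρ : Fin 4),
      HasSum (fun t : Fin 4 → ℤ => t ρ • TbalOf Lc (JsBalOf hLc cE cVH cΛ W Cw δw hδw hW) j c e t) 0)
    (h𝒯0 : ∀ m, 1 ≤ m → ∀ c e : Fin 4, HasSum (TshotOf Lc Jc m c e) 0)
    (h𝒯1 : ∀ m, 1 ≤ m → ∀ c e ρ : Fin 4, HasSum (fun t : Fin 4 → ℤ => t ρ • TshotOf Lc Jc m c e t) 0)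
    (hbase : TshotOf Lc Jc 1 = TbalOf Lc (JsBalOf hLc cE cVH cΛ W Cw δw hδw hW) 0)
    (hSF : SDInvisible Lc (JsBalOf hLc cE cVH cΛ W Cw δw hδw hW) Jc μ ν)
    {cc : ℝ} {M : ℕ → ℕ}
    (hc : 1 ≤ cc) (hM : ∀ L : ℕ, 2 ≤ L → 1 ≤ M L ∧ (L : ℝ) ≤ cc * M L) (hML : ∀ L : ℕ, 2 ≤ L → M L ≤ L)
    (hrep : D1Rep Lc Jc N μ ν a SL k)
    {rr γ₀ β₀ : ℝ} (hγ₀ : 0 < γ₀) (hrem : RemainderConst S γ₀ rr) (hr : rr < B12Normalization.stepBal N Lc)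
    (hcont : BetaContH γ₀ β) (hβ₀ : 0 < β₀) {L : ℕ} (hL2 : 2 ≤ L) (p : ℕ) {κ₀ : ℕ} (hκ : 6 ≤ κ₀) :
    EndpointExistence C ∧ ∃ A : ℝ, ∃ γ₁ : ℝ, 0 < γ₁ ∧
      ∀ γ : ℝ, 0 < γ → γ ≤ min γ₀ γ₁ → ∀ Pr : B12.RunParams, (C Pr).flow.InInterval γ Pr.K →
        ∀ p' : ℕ, p' ≤ p → ∀ A₀ : ℝ, 0 ≤ A₀ →
          ∃ Rj : ℕ → ℕ, (∀ j, B14.IsRj L p' ((C Pr).flow.g j) (Rj j)) ∧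
            HorizonFacts (C Pr).flow (B12Normalization.stepBal N Lc + 2 * A + rr) β₀ A₀ L p' κ₀ Rj Pr.K :=
  wallEND_of_sdInvisible_D1Rep_cont_allProfiles a ha h12 h126 hSL k hgen hhalt hcur S hμν hN hL
    (JsBalOf hLc cE cVH cΛ W Cw δw hδw hW) Jc hβ hT0 hT1 h𝒯0 h𝒯1 hbase hSF hc hM hML hrep hγ₀ hrem hr hcont hβ₀ hL2 p hκ

/-- **THE MINIMAL [III] CARRIER FROM THE CENSUS FORM, STEP FAMILY CLOSED**: the binders of `d1Drift_of_sdInvisible_D1Rep` at `Js := JsBalOf …`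
+ `hβ` + (D4) ⟹ `∃ A, BetaAvgAFH (stepBal N Lc − rr) (2A) γ β`. [folklore] -/
theorem betaAvgAFH_of_sdInvisible_D1Rep_JsBalOf (a : ℝ) (ha : 0 < a)
    (h12 : B5.Prop12Printed (fam (fun i : ℕ+ × ℕ => ((i.1 : ℕ+) : ℕ)) (fun i => i.1.pos) MvE a ha))
    (h126 : B5.Kernel126_127Printed (kfam (fun i : ℕ+ × ℕ => ((i.1 : ℕ+) : ℕ)) MvE))
    {SL : Finset Λ} (hSL : SL.Nonempty) (k : Λ → Fin 4) {μ ν : Fin 4}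
    (S : B12Beta.OneLoopSplit β) (hμν : μ ≠ ν) {N : ℝ} (hN : N ≠ 0) (hL : 2 ≤ Lc)
    (Jc : ∀ m : ℕ, JetData 3 (Lc ^ m))
    (hβ : ∀ j, S.β0 j = secondMoment (TbalOf Lc (JsBalOf hLc cE cVH cΛ W Cw δw hδw hW) j) μ ν)
    (hT0 : ∀ j (c e : Fin 4), HasSum (TbalOf Lc (JsBalOf hLc cE cVH cΛ W Cw δw hδw hW) j c e) 0)
    (hT1 : ∀ j (c e ρ : Fin 4),
      HasSum (fun t : Fin 4 → ℤ => t ρ • TbalOf Lc (JsBalOf hLc cE cVH cΛ W Cw δw hδw hW) j c e t) 0)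
    (h𝒯0 : ∀ m, 1 ≤ m → ∀ c e : Fin 4, HasSum (TshotOf Lc Jc m c e) 0)
    (h𝒯1 : ∀ m, 1 ≤ m → ∀ c e ρ : Fin 4, HasSum (fun t : Fin 4 → ℤ => t ρ • TshotOf Lc Jc m c e t) 0)
    (hbase : TshotOf Lc Jc 1 = TbalOf Lc (JsBalOf hLc cE cVH cΛ W Cw δw hδw hW) 0)
    (hSF : SDInvisible Lc (JsBalOf hLc cE cVH cΛ W Cw δw hδw hW) Jc μ ν)
    {cc : ℝ} {M : ℕ → ℕ}
    (hc : 1 ≤ cc) (hM : ∀ L : ℕ, 2 ≤ L → 1 ≤ M L ∧ (L : ℝ) ≤ cc * M L) (hML : ∀ L : ℕ, 2 ≤ L → M L ≤ L)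
    (hrep : D1Rep Lc Jc N μ ν a SL k) {γ rr : ℝ} (hrem : RemainderConst S γ rr) :
    ∃ A : ℝ, BetaAvgAFH (B12Normalization.stepBal N Lc - rr) (2 * A) γ β :=
  betaAvgAFH_of_sdInvisible_D1Rep a ha h12 h126 hSL k S hμν hN hL (JsBalOf hLc cE cVH cΛ W Cw δw hδw hW) Jc hβ hT0 hT1
    h𝒯0 h𝒯1 hbase hSF hc hM hML hrep hrem

end CensusForm

end Literature.MathematicalPhysics.QuantumFieldTheory.Balaban1983to89.Beta.AveragedAFCarrierJsBal

end
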